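import Summits.QuantumFields.BalabanUV.Beta.D1BFx.WardJetsUnpacked

/-!
# `BalabanUV.Beta.D1BFx.PackedWardParitySplit` — road «BF-x» for binder row D1, slot (K), brick «A1-PACKED-TORUS» of the owner's
# `A1-PACKED-SPEC.md` v0 (b2b-balaban-beta-d1-p2 gen 15): **THE PARITY SPLIT OF THE PACKED WARD RELATION** — PART 1 of the kernel form of the
# CHECK Q-A1P-1 (b) the spec asks of this lineage before anyone types (B3); PART 2 (`PackedWardLiftOddDrop`) is the lift no-go + brick (B2) «ODD-DROP»

HONEST DEPENDENCY (cell records, verbatim): «continuum YM on T⁴ ⇐ BetaPertH ∧ nine spine estimates (0/9 proved); BetaPertH ⇐ (D1) ∧ (D4) ∧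
CAP+tail; G-an2-4 gates asym, D1 and NE2/3/4.»  HONEST FRAMING (cell contract, verbatim): «discharging `BetaPertH` makes Bałaban's UV stability
UNCONDITIONAL — a real constructive-QFT result; it is NOT the continuum limit and NOT the Clay problem.»  THIS MODULE DISCHARGES NOTHING of (K),
of D1 or of the wall: it is [folklore] finite-dimensional matrix algebra (Mathlib) over ABSTRACT data and the tree's `WardJetsFromNoether`
(`oslot`, `packedWard₁`, `packedWard₂` and its contraction rules) and `WardJetsUnpacked` (the `ν ⊕ μ` block bookkeeping) BY NAME.  No definition, no `def … : Prop`,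
nothing cited, 0 sorry.  It instantiates NO table of the cell.  NOT D1, NOT BetaPertH, NOT continuum, NOT Clay.

ABSOLUTE RULE (cell charter, verbatim): «No internally-minted statement may enter as a cited fact. Every hypothesis is either kernel-proved in this
package or a verbatim quotation of a PUBLISHED theorem with page reference. The manuscript(s) under audit are NOT citable for their own disputed
steps — they are the thing under adjudication; programme-internal (2001/route/tribunal) claims are never citable.»

WHERE THIS SITS (`HOME/b2b-balaban-beta-d1-p2/A1-PACKED-SPEC.md` v0 §3–§5).  The per-torus stripped identity
`KCombineCovColourTorus.identity_array_currency_cov_What0_stripped` needs the PARITY TYPES `kₛₜᵀ = kₛₜ`, `Aₛₜᵀ = Aₛₜ` and the ONE-SIDED mixed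
WARD-L letter `aₛₜ`.  The response-packed second jet of `WardJetsFromNoether.packedWard₂` is `𝕄ₛₜ = Σ rₛᵏrₜˡ•𝕄₂ k l + Σ rₛₜᵏ•𝕄₁ k = even + odd`
(the odd part — first-order tables against the SECOND response — is antisymmetric in the cell's colourless placement: leaf-03 g19's located
parity point, journal W-d1leaf03g19-1).  The spec's proposed resolution «ODD-DROP BY COLOUR TRACE» (§3) feeds the EVEN parts to the stripped
identity and drops the odd parts from the four tadpole slots; it rests on the line «the EVEN tuple satisfies the full mixed letters … the ODD
tuple satisfies the first-order letter shape (`packedWard₁` at `r := rₛₜ`)» (g19's UNVERIFIED sketch, flagged «to be CHECKED … Q-A1P-1 (b)»).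
THIS FILE IS THE CHECK, in the kernel: `packedWard₁` at `r := rₛₜ` needs the source condition `oslot X₁ (𝕄₀ *ᵥ rₛₜ) = 0`, which the second
response does NOT have (`𝕄₀·rₛₜ = −𝕄ₜ·rₛ` has field rows); WITHOUT it the two halves of `packedWard₂` each miss their letter by the SAME
matrix with OPPOSITE signs — `R := oslot X₁ (𝕄ₜ *ᵥ rₛ)`, the doubly weighted table-`oslot` term of [P2] — and only their SUM is a Ward relation.
* §1 THE SPLIT (abstract packed index `σ`, any `ρ`; [P1], [P2] and the two FIRST-order source conditions ONLY — NO `hst`):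
  `packedWard₁_eq` — `(Σ r•𝕄₁)·Ŵ₀ + 𝕄₀·(Σ r•X₁) = −oslot X₁ (𝕄₀ *ᵥ r)` for ANY weight `r`;
  **`packedWard₂_even_eq`** — the EVEN tuple satisfies the mixed letter UP TO `−R`;
  **`packedWard₂_odd_eq_of_hst`** — under `hst` the ODD tuple satisfies the first-order letter shape UP TO `+R`;
  `packedWard₂_of_split` — their sum is the tree's `packedWard₂` (consistency); **`packedWard₂_even_iff`** — the even letter holds IFF `R = 0`.
* §2 READ-OUT on `σ = ν ⊕ μ`: for generators with no multiplier table (`x₁ (inr m) = 0`) `R` has NO multiplier rows (`oslot_fromRows_inr_eq_zero`,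
  `oslot_fromRows_eq`; field rows = `WardJetsUnpacked.oslot_fromRows_zero_apply`), so the even tuple satisfies the KINEMATIC letter `bₛₜ` EXACTLY and the WARD-L letter `aₛₜ` up to MINUS the field block
  `R_K j a = Σ_{i:ν} (kkt Kₜ Qₜ *ᵥ rₛ) (inl i) · x₁ (inl j) i a` (**`ward₂_even`**); for single-row generators `R_K j a = (𝕄ₜrₛ)_{inl j} · Nt j a`
  (`R_field_singleRow`).
CONSEQUENCE (records, not Lean): the spec's §4 line `exact identity_array_currency_cov_What0_stripped … (even data) …` cannot take its `aₛₜ`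
argument from `packedWard₂`; it needs the extra letter «R-NULL» `R_K = 0` (PART 2 shows no colour dressing of the lift removes it).
Provenance: D1 formalisation swarm leaf seat `b2b-balaban-beta-d1-formalise-leaf-03` gen 20 (INTENT I-d1leaf03g20-1), 2026-08-22.
-/

noncomputable section

namespace Summit.QuantumFields.BalabanUV.Beta.D1BFx.PackedWardParitySplit

open Matrix
open scoped BigOperators
open Literature.MathematicalPhysics.QuantumFieldTheory.Balaban1983to89.Beta.Composition (kkt)
open Summit.QuantumFields.BalabanUV.Beta.D1BFx.WardJetsFromNoether (oslot oslot_apply oslot_add packedWard₂ sum_smul_oslot_col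
  sum_sum_smul_oslot_col sum_sum_smul_oslot_table sum_smul_mul mul_sum_smul sum_smul_mul_sum_smul sum_smul_kkt sum_smul_fromRows_zero
  kkt_mul_fromRows_zero fromRows_add_fromRows oslot_fromRows_zero_eq_zero)
open Summit.QuantumFields.BalabanUV.Beta.D1BFx.WardJetsUnpacked (sum_sum_smul_kkt sum_sum_smul_fromRows_zero oslot_fromRows_zero_apply)

/-! ## §1 The parity split of the packed Ward relation (no `hst`) -/

section Split

variable {σ ρ : Type*} [Fintype σ]

/-- [folklore] **[P1] SUMMED AGAINST AN ARBITRARY WEIGHT.**  With NO source condition on `r`, the total jets `Σ r•𝕄₁`, `Σ r•X₁` satisfy the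
first-order letter shape UP TO the other-slot read-out at the weight `𝕄₀ *ᵥ r`:
`(Σ r•𝕄₁)·Ŵ₀ + 𝕄₀·(Σ r•X₁) = −oslot X₁ (𝕄₀ *ᵥ r)`.  (`packedWard₁` is the case `oslot X₁ (𝕄₀ *ᵥ r) = 0`.) -/
theorem packedWard₁_eq (𝕄₀ : Matrix σ σ ℝ) (𝕄₁ : σ → Matrix σ σ ℝ) (Ŵ₀ : Matrix σ ρ ℝ) (X₁ : σ → Matrix σ ρ ℝ)
    (hP1 : ∀ k, 𝕄₁ k * Ŵ₀ + 𝕄₀ * X₁ k + oslot X₁ (fun i => 𝕄₀ i k) = 0) (r : σ → ℝ) :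
    (∑ k, r k • 𝕄₁ k) * Ŵ₀ + 𝕄₀ * (∑ k, r k • X₁ k) = -oslot X₁ (𝕄₀ *ᵥ r) := by
  have h : ∑ k, r k • (𝕄₁ k * Ŵ₀ + 𝕄₀ * X₁ k + oslot X₁ (fun i => 𝕄₀ i k)) = 0 :=
    Finset.sum_eq_zero fun k _ => by rw [hP1 k, smul_zero]
  simp only [smul_add, Finset.sum_add_distrib, sum_smul_oslot_col] at h
  rw [sum_smul_mul, mul_sum_smul]
  exact eq_neg_of_add_eq_zero_left h

/-- [folklore] **THE EVEN PART OF `packedWard₂`.**  From [P2] and the two FIRST-order source conditions ONLY (`oslot (X₂ ·) (𝕄₀ *ᵥ rₛ) = 0`,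
`oslot (X₂ ·) (𝕄₀ *ᵥ rₜ) = 0`; NO `hst`), the EVEN packed tuple `k_e := Σ rₛᵏrₜˡ•𝕄₂ k l`, `w_e := Σ rₛᵏrₜˡ•X₂ k l` satisfies the mixed letter
UP TO `−R`, `R := oslot X₁ (𝕄ₜ *ᵥ rₛ)`, `𝕄ₜ := Σ rₜ•𝕄₁` — the doubly weighted table-`oslot` term of [P2]:
`k_e·Ŵ₀ + 𝕄ₛ·Ŵₜ + 𝕄ₜ·Ŵₛ + 𝕄₀·w_e = −oslot X₁ (𝕄ₜ *ᵥ rₛ)`. -/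
theorem packedWard₂_even_eq (𝕄₀ : Matrix σ σ ℝ) (𝕄₁ : σ → Matrix σ σ ℝ) (𝕄₂ : σ → σ → Matrix σ σ ℝ)
    (Ŵ₀ : Matrix σ ρ ℝ) (X₁ : σ → Matrix σ ρ ℝ) (X₂ : σ → σ → Matrix σ ρ ℝ)
    (hP2 : ∀ k l, 𝕄₂ k l * Ŵ₀ + 𝕄₁ k * X₁ l + 𝕄₁ l * X₁ k + 𝕄₀ * X₂ k l
      + oslot X₁ (fun i => 𝕄₁ l i k) + oslot (X₂ l) (fun i => 𝕄₀ i k) + oslot (X₂ k) (fun i => 𝕄₀ i l) = 0)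
    (rs rt : σ → ℝ) (hs₂ : ∀ l, oslot (X₂ l) (𝕄₀ *ᵥ rs) = 0) (ht₂ : ∀ k, oslot (X₂ k) (𝕄₀ *ᵥ rt) = 0) :
    (∑ k, ∑ l, (rs k * rt l) • 𝕄₂ k l) * Ŵ₀ + (∑ k, rs k • 𝕄₁ k) * (∑ l, rt l • X₁ l) + (∑ l, rt l • 𝕄₁ l) * (∑ k, rs k • X₁ k)
        + 𝕄₀ * (∑ k, ∑ l, (rs k * rt l) • X₂ k l)
      = -oslot X₁ ((∑ l, rt l • 𝕄₁ l) *ᵥ rs) := by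
  have hA : ∑ k, ∑ l, (rs k * rt l) • (𝕄₂ k l * Ŵ₀ + 𝕄₁ k * X₁ l + 𝕄₁ l * X₁ k + 𝕄₀ * X₂ k l
      + oslot X₁ (fun i => 𝕄₁ l i k) + oslot (X₂ l) (fun i => 𝕄₀ i k) + oslot (X₂ k) (fun i => 𝕄₀ i l)) = 0 :=
    Finset.sum_eq_zero fun k _ => Finset.sum_eq_zero fun l _ => by rw [hP2 k l, smul_zero]
  have hT2 : ∑ k, ∑ l, (rs k * rt l) • oslot (X₂ l) (fun i => 𝕄₀ i k) = 0 := by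
    rw [sum_sum_smul_oslot_col]
    exact Finset.sum_eq_zero fun l _ => by rw [hs₂ l, smul_zero]
  have hT3 : ∑ k, ∑ l, (rs k * rt l) • oslot (X₂ k) (fun i => 𝕄₀ i l) = 0 := by
    rw [Finset.sum_comm]
    have : ∑ l, ∑ k, (rs k * rt l) • oslot (X₂ k) (fun i => 𝕄₀ i l)
        = ∑ l, ∑ k, (rt l * rs k) • oslot (X₂ k) (fun i => 𝕄₀ i l) :=
      Finset.sum_congr rfl fun l _ => Finset.sum_congr rfl fun k _ => by rw [mul_comm]
    rw [this, sum_sum_smul_oslot_col]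
    exact Finset.sum_eq_zero fun k _ => by rw [ht₂ k, smul_zero]
  have hT1 : ∑ k, ∑ l, (rs k * rt l) • oslot X₁ (fun i => 𝕄₁ l i k) = oslot X₁ ((∑ l, rt l • 𝕄₁ l) *ᵥ rs) :=
    sum_sum_smul_oslot_table X₁ 𝕄₁ rs rt
  simp only [smul_add, Finset.sum_add_distrib] at hA
  rw [hT2, hT3, add_zero, add_zero, hT1] at hA
  have e1 : (∑ k, ∑ l, (rs k * rt l) • 𝕄₂ k l) * Ŵ₀ = ∑ k, ∑ l, (rs k * rt l) • (𝕄₂ k l * Ŵ₀) := by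
    rw [Matrix.sum_mul]
    refine Finset.sum_congr rfl fun k _ => ?_
    rw [Matrix.sum_mul]
    simp_rw [Matrix.smul_mul]
  have e2 : (∑ k, rs k • 𝕄₁ k) * (∑ l, rt l • X₁ l) = ∑ k, ∑ l, (rs k * rt l) • (𝕄₁ k * X₁ l) :=
    sum_smul_mul_sum_smul rs rt 𝕄₁ X₁
  have e3 : (∑ l, rt l • 𝕄₁ l) * (∑ k, rs k • X₁ k) = ∑ k, ∑ l, (rs k * rt l) • (𝕄₁ l * X₁ k) := by
    rw [sum_smul_mul_sum_smul, Finset.sum_comm]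
    exact Finset.sum_congr rfl fun k _ => Finset.sum_congr rfl fun l _ => by rw [mul_comm]
  have e4 : 𝕄₀ * (∑ k, ∑ l, (rs k * rt l) • X₂ k l) = ∑ k, ∑ l, (rs k * rt l) • (𝕄₀ * X₂ k l) := by
    rw [Matrix.mul_sum]
    refine Finset.sum_congr rfl fun k _ => ?_
    rw [Matrix.mul_sum]
    simp_rw [Matrix.mul_smul]
  rw [e1, e2, e3, e4]
  exact eq_neg_of_add_eq_zero_left hA

/-- [folklore] **THE ODD PART UNDER `hst`** (the RAW odd part is `packedWard₁_eq` at `r := rₛₜ`: `k_o·Ŵ₀ + 𝕄₀·w_o = −oslot X₁ (𝕄₀ *ᵥ rₛₜ)`,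
`k_o := Σ rₛₜ•𝕄₁`, `w_o := Σ rₛₜ•X₁` — the source of the SECOND response is not confined to the multiplier rows, so `oslot_fromRows_zero_eq_zero`
does not apply to it) (`oslot X₁ (𝕄₀ *ᵥ rₛₜ + 𝕄ₜ *ᵥ rₛ) = 0`, the shape `K₂ = −K(∂𝕄)K`): the odd tuple satisfies the
first-order letter shape UP TO `+R`: `k_o·Ŵ₀ + 𝕄₀·w_o = +oslot X₁ (𝕄ₜ *ᵥ rₛ)` — equal and OPPOSITE to the even defect. -/
theorem packedWard₂_odd_eq_of_hst (𝕄₀ : Matrix σ σ ℝ) (𝕄₁ : σ → Matrix σ σ ℝ) (Ŵ₀ : Matrix σ ρ ℝ) (X₁ : σ → Matrix σ ρ ℝ)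
    (hP1 : ∀ k, 𝕄₁ k * Ŵ₀ + 𝕄₀ * X₁ k + oslot X₁ (fun i => 𝕄₀ i k) = 0) (rs rt rst : σ → ℝ)
    (hst : oslot X₁ (𝕄₀ *ᵥ rst + (∑ l, rt l • 𝕄₁ l) *ᵥ rs) = 0) :
    (∑ k, rst k • 𝕄₁ k) * Ŵ₀ + 𝕄₀ * (∑ k, rst k • X₁ k) = oslot X₁ ((∑ l, rt l • 𝕄₁ l) *ᵥ rs) := by
  rw [packedWard₁_eq 𝕄₀ 𝕄₁ Ŵ₀ X₁ hP1 rst]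
  rw [oslot_add] at hst
  exact (eq_neg_of_add_eq_zero_left hst).symm ▸ neg_neg _

/-- [folklore] CONSISTENCY: the even and odd parts ADD UP to the tree's `packedWard₂` (the two defects `∓R` cancel). -/
theorem packedWard₂_of_split (𝕄₀ : Matrix σ σ ℝ) (𝕄₁ : σ → Matrix σ σ ℝ) (𝕄₂ : σ → σ → Matrix σ σ ℝ)
    (Ŵ₀ : Matrix σ ρ ℝ) (X₁ : σ → Matrix σ ρ ℝ) (X₂ : σ → σ → Matrix σ ρ ℝ)
    (hP1 : ∀ k, 𝕄₁ k * Ŵ₀ + 𝕄₀ * X₁ k + oslot X₁ (fun i => 𝕄₀ i k) = 0)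
    (hP2 : ∀ k l, 𝕄₂ k l * Ŵ₀ + 𝕄₁ k * X₁ l + 𝕄₁ l * X₁ k + 𝕄₀ * X₂ k l
      + oslot X₁ (fun i => 𝕄₁ l i k) + oslot (X₂ l) (fun i => 𝕄₀ i k) + oslot (X₂ k) (fun i => 𝕄₀ i l) = 0)
    (rs rt rst : σ → ℝ)
    (hs₂ : ∀ l, oslot (X₂ l) (𝕄₀ *ᵥ rs) = 0) (ht₂ : ∀ k, oslot (X₂ k) (𝕄₀ *ᵥ rt) = 0)
    (hst : oslot X₁ (𝕄₀ *ᵥ rst + (∑ l, rt l • 𝕄₁ l) *ᵥ rs) = 0) :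
    (∑ k, ∑ l, (rs k * rt l) • 𝕄₂ k l + ∑ k, rst k • 𝕄₁ k) * Ŵ₀
      + (∑ k, rs k • 𝕄₁ k) * (∑ l, rt l • X₁ l) + (∑ l, rt l • 𝕄₁ l) * (∑ k, rs k • X₁ k)
      + 𝕄₀ * (∑ k, ∑ l, (rs k * rt l) • X₂ k l + ∑ k, rst k • X₁ k) = 0 := by
  have hE := packedWard₂_even_eq 𝕄₀ 𝕄₁ 𝕄₂ Ŵ₀ X₁ X₂ hP2 rs rt hs₂ ht₂
  have hO := packedWard₂_odd_eq_of_hst 𝕄₀ 𝕄₁ Ŵ₀ X₁ hP1 rs rt rst hst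
  rw [Matrix.add_mul, Matrix.mul_add]
  rw [show (∑ k, ∑ l, (rs k * rt l) • 𝕄₂ k l) * Ŵ₀ + (∑ k, rst k • 𝕄₁ k) * Ŵ₀
        + (∑ k, rs k • 𝕄₁ k) * (∑ l, rt l • X₁ l) + (∑ l, rt l • 𝕄₁ l) * (∑ k, rs k • X₁ k)
        + (𝕄₀ * (∑ k, ∑ l, (rs k * rt l) • X₂ k l) + 𝕄₀ * (∑ k, rst k • X₁ k))
      = ((∑ k, ∑ l, (rs k * rt l) • 𝕄₂ k l) * Ŵ₀ + (∑ k, rs k • 𝕄₁ k) * (∑ l, rt l • X₁ l)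
          + (∑ l, rt l • 𝕄₁ l) * (∑ k, rs k • X₁ k) + 𝕄₀ * (∑ k, ∑ l, (rs k * rt l) • X₂ k l))
        + ((∑ k, rst k • 𝕄₁ k) * Ŵ₀ + 𝕄₀ * (∑ k, rst k • X₁ k)) by abel, hE, hO, neg_add_cancel]

/-- [folklore] **THE EVEN TUPLE SATISFIES THE MIXED LETTER IFF «R-NULL»** `oslot X₁ (𝕄ₜ *ᵥ rₛ) = 0`. -/
theorem packedWard₂_even_iff (𝕄₀ : Matrix σ σ ℝ) (𝕄₁ : σ → Matrix σ σ ℝ) (𝕄₂ : σ → σ → Matrix σ σ ℝ)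
    (Ŵ₀ : Matrix σ ρ ℝ) (X₁ : σ → Matrix σ ρ ℝ) (X₂ : σ → σ → Matrix σ ρ ℝ)
    (hP2 : ∀ k l, 𝕄₂ k l * Ŵ₀ + 𝕄₁ k * X₁ l + 𝕄₁ l * X₁ k + 𝕄₀ * X₂ k l
      + oslot X₁ (fun i => 𝕄₁ l i k) + oslot (X₂ l) (fun i => 𝕄₀ i k) + oslot (X₂ k) (fun i => 𝕄₀ i l) = 0)
    (rs rt : σ → ℝ) (hs₂ : ∀ l, oslot (X₂ l) (𝕄₀ *ᵥ rs) = 0) (ht₂ : ∀ k, oslot (X₂ k) (𝕄₀ *ᵥ rt) = 0) :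
    (∑ k, ∑ l, (rs k * rt l) • 𝕄₂ k l) * Ŵ₀ + (∑ k, rs k • 𝕄₁ k) * (∑ l, rt l • X₁ l) + (∑ l, rt l • 𝕄₁ l) * (∑ k, rs k • X₁ k)
        + 𝕄₀ * (∑ k, ∑ l, (rs k * rt l) • X₂ k l) = 0
      ↔ oslot X₁ ((∑ l, rt l • 𝕄₁ l) *ᵥ rs) = 0 := by
  rw [packedWard₂_even_eq 𝕄₀ 𝕄₁ 𝕄₂ Ŵ₀ X₁ X₂ hP2 rs rt hs₂ ht₂, neg_eq_zero]

end Split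

/-! ## §2 Read-out on `ν ⊕ μ`: `bₛₜ` holds for the even tuple, `aₛₜ` misses by the field block of `R` -/

section Unpacked

variable {ν μ ρ : Type*} [Fintype ν] [Fintype μ]

/-- [folklore] For generators with NO table in the multiplier directions (`x₁ (inr m) = 0`: the gauge action does not depend on the
multiplier) the other-slot read-out has NO MULTIPLIER ROWS, whatever the weight. -/
theorem oslot_fromRows_inr_eq_zero (x₁ : ν ⊕ μ → Matrix ν ρ ℝ) (hx : ∀ m : μ, x₁ (Sum.inr m) = 0) (w : ν ⊕ μ → ℝ) (m : μ) (a : ρ) :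
    oslot (fun k => fromRows (x₁ k) (0 : Matrix μ ρ ℝ)) w (Sum.inr m) a = 0 := by
  rw [oslot_apply]
  exact Finset.sum_eq_zero fun i _ => by rw [hx m, Matrix.fromRows_zero, Matrix.zero_apply, mul_zero]

/-- [folklore] The other-slot read-out of a field-rows generator family with no multiplier table IS a field-rows matrix. -/
theorem oslot_fromRows_eq (x₁ : ν ⊕ μ → Matrix ν ρ ℝ) (hx : ∀ m : μ, x₁ (Sum.inr m) = 0) (w : ν ⊕ μ → ℝ) :
    oslot (fun k => fromRows (x₁ k) (0 : Matrix μ ρ ℝ)) w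
      = fromRows (Matrix.of fun j a => ∑ i : ν, w (Sum.inl i) * x₁ (Sum.inl j) i a) (0 : Matrix μ ρ ℝ) := by
  ext j a
  rcases j with j | m
  · rw [oslot_fromRows_zero_apply, Matrix.fromRows_apply_inl, Matrix.of_apply]
  · rw [oslot_fromRows_inr_eq_zero x₁ hx, Matrix.fromRows_apply_inr, Matrix.zero_apply]

omit [Fintype ν] [Fintype μ] in
/-- [folklore] `fromRows A B = fromRows C D` iff blockwise. -/
theorem fromRows_eq_fromRows_iff (A C : Matrix ν ρ ℝ) (B D : Matrix μ ρ ℝ) : fromRows A B = fromRows C D ↔ A = C ∧ B = D :=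
  ⟨fun h => Matrix.fromRows_inj h, fun h => by rw [h.1, h.2]⟩

omit [Fintype ν] [Fintype μ] in
/-- [folklore] Negation of a field-rows matrix. -/
theorem neg_fromRows_zero (A : Matrix ν ρ ℝ) : -fromRows A (0 : Matrix μ ρ ℝ) = fromRows (-A) (0 : Matrix μ ρ ℝ) := by
  ext i a
  rcases i with i | i <;> simp [Matrix.fromRows]

/-- [folklore] **`ward₂` FOR THE EVEN TUPLE — THE LOCATED DEFECT.**  Tables `K₁ Q₁ K₂ Q₂`, generators `W₀ x₁ x₂` with NO multiplier table
(`x₁ (inr m) = 0`), base `K₀ Q₀`; hypotheses = the packed [P2] and the FIRST-order source conditions (vanishing field KKT rows of `rs`, `rt`)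
ONLY.  With `K_e := Σ rs rt•K₂`, `Q_e`, `w_e := Σ rs rt•x₂`, `Kₜ := Σ rt•K₁`, `Qₜ`, `wₜ := Σ rt•x₁` (and `ₛ`):
the WARD-L mixed letter holds UP TO `−R_K`, `R_K j a := Σ_{i:ν} (kkt Kₜ Qₜ *ᵥ rs) (inl i) · x₁ (inl j) i a`, and the KINEMATIC mixed letter EXACTLY:
`K_e·W₀ + Kₛ·wₜ + Kₜ·wₛ + K₀·w_e = −R_K ∧ Q_e·W₀ + Qₛ·wₜ + Qₜ·wₛ + Q₀·w_e = 0`. -/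
theorem ward₂_even (K₀ : Matrix ν ν ℝ) (Q₀ : Matrix μ ν ℝ) (K₁ : ν ⊕ μ → Matrix ν ν ℝ) (Q₁ : ν ⊕ μ → Matrix μ ν ℝ)
    (K₂ : ν ⊕ μ → ν ⊕ μ → Matrix ν ν ℝ) (Q₂ : ν ⊕ μ → ν ⊕ μ → Matrix μ ν ℝ)
    (W₀ : Matrix ν ρ ℝ) (x₁ : ν ⊕ μ → Matrix ν ρ ℝ) (x₂ : ν ⊕ μ → ν ⊕ μ → Matrix ν ρ ℝ) (hx : ∀ m : μ, x₁ (Sum.inr m) = 0)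
    (hP2 : ∀ k l, kkt (K₂ k l) (Q₂ k l) * fromRows W₀ (0 : Matrix μ ρ ℝ) + kkt (K₁ k) (Q₁ k) * fromRows (x₁ l) (0 : Matrix μ ρ ℝ)
      + kkt (K₁ l) (Q₁ l) * fromRows (x₁ k) (0 : Matrix μ ρ ℝ) + kkt K₀ Q₀ * fromRows (x₂ k l) (0 : Matrix μ ρ ℝ)
      + oslot (fun j => fromRows (x₁ j) (0 : Matrix μ ρ ℝ)) (fun i => kkt (K₁ l) (Q₁ l) i k)
      + oslot (fun j => fromRows (x₂ l j) (0 : Matrix μ ρ ℝ)) (fun i => kkt K₀ Q₀ i k)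
      + oslot (fun j => fromRows (x₂ k j) (0 : Matrix μ ρ ℝ)) (fun i => kkt K₀ Q₀ i l) = 0)
    (rs rt : ν ⊕ μ → ℝ)
    (hs : ∀ i : ν, (kkt K₀ Q₀ *ᵥ rs) (Sum.inl i) = 0) (ht : ∀ i : ν, (kkt K₀ Q₀ *ᵥ rt) (Sum.inl i) = 0) :
    (∑ k, ∑ l, (rs k * rt l) • K₂ k l) * W₀ + (∑ k, rs k • K₁ k) * (∑ l, rt l • x₁ l)
        + (∑ l, rt l • K₁ l) * (∑ k, rs k • x₁ k) + K₀ * (∑ k, ∑ l, (rs k * rt l) • x₂ k l)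
      = -Matrix.of (fun j a => ∑ i : ν, (kkt (∑ l, rt l • K₁ l) (∑ l, rt l • Q₁ l) *ᵥ rs) (Sum.inl i) * x₁ (Sum.inl j) i a)
    ∧ (∑ k, ∑ l, (rs k * rt l) • Q₂ k l) * W₀ + (∑ k, rs k • Q₁ k) * (∑ l, rt l • x₁ l)
        + (∑ l, rt l • Q₁ l) * (∑ k, rs k • x₁ k) + Q₀ * (∑ k, ∑ l, (rs k * rt l) • x₂ k l) = 0 := by
  have h := packedWard₂_even_eq (kkt K₀ Q₀) (fun k => kkt (K₁ k) (Q₁ k)) (fun k l => kkt (K₂ k l) (Q₂ k l)) (fromRows W₀ (0 : Matrix μ ρ ℝ))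
    (fun k => fromRows (x₁ k) (0 : Matrix μ ρ ℝ)) (fun k l => fromRows (x₂ k l) (0 : Matrix μ ρ ℝ)) hP2 rs rt
    (fun l => oslot_fromRows_zero_eq_zero (x₂ l) _ hs) (fun k => oslot_fromRows_zero_eq_zero (x₂ k) _ ht)
  rw [sum_sum_smul_kkt, sum_smul_kkt, sum_smul_kkt, sum_smul_fromRows_zero, sum_smul_fromRows_zero, sum_sum_smul_fromRows_zero,
    kkt_mul_fromRows_zero, kkt_mul_fromRows_zero, kkt_mul_fromRows_zero, kkt_mul_fromRows_zero, fromRows_add_fromRows, fromRows_add_fromRows,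
    fromRows_add_fromRows, oslot_fromRows_eq x₁ hx, neg_fromRows_zero, fromRows_eq_fromRows_iff] at h
  exact h

omit [Fintype μ] in
/-- [folklore] For SINGLE-ROW generators (`x₁ k i a = [inl i = k]·Nt i a`: the derivative of the gauge action in link direction `k` touches
row `k` only) the field block of `R` is the ROW-SCALED table `R_K j a = (kkt Kₜ Qₜ *ᵥ rs) (inl j) · Nt j a` — it vanishes iff, row by row, the
field KKT row of the second response's source `𝕄ₜ *ᵥ rₛ` or the generator row vanishes. -/
theorem R_field_singleRow (Nt : ν → ρ → ℝ) (x₁ : ν ⊕ μ → Matrix ν ρ ℝ) [DecidableEq ν] [DecidableEq μ]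
    (hx : ∀ k i a, x₁ k i a = if Sum.inl i = k then Nt i a else 0) (v : ν ⊕ μ → ℝ) (j : ν) (a : ρ) :
    ∑ i : ν, v (Sum.inl i) * x₁ (Sum.inl j) i a = v (Sum.inl j) * Nt j a := by
  simp only [hx, Sum.inl.injEq]
  rw [Finset.sum_eq_single j (fun i _ hij => by rw [if_neg hij, mul_zero]) (fun hj => absurd (Finset.mem_univ j) hj), if_pos rfl]

end Unpacked

end Summit.QuantumFields.BalabanUV.Beta.D1BFx.PackedWardParitySplit

end
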